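import Summits.ValiantsHypothesis.ValiantsHypothesis.Theorems.KPlusLogSqLawTropicalBTopHeavyCoreArc

/-!
# Route «KPlusLogSqLaw», crux `TropicalB` (stmt-ValiantsHypothesis-19771) — ARC CHOICE LEMMAS for multi-column transfers:
# an arc containing `c` exists; and one exists that ends outside a forbidden set `L` or leaves a column outside `L` uncovered

HONEST FRAMING.  Toolkit (val-sym-trop-p1 g21, cell `pub-symmetroid`, 2026-08-28; `--supports stmt-ValiantsHypothesis-19771 --as helper`), sequel of
…TopHeavyCoreArc (`exists_arcFamily`, `cover_eq`, `exists_arc`) and …TopHeavyCoreTransversal.  Pure combinatorics of a fixed-point-free single-cycle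
permutation `P` of `Fin m`, an arbitrary permutation `τ`, and the chain of `P`-arcs `U j` (`τ j ≠ j`) from `P (τ⁻¹ j)` to `j`; everything follows from
the COVERING-NUMBER INVARIANCE `cover_eq` (every column lies in the same number of arcs).  These are the arc-existence steps of the first two-raised
transfer law (memo CORE-LAW-C-g21 §9, deposit HOME/val-sym-trop-p1/g21/); nothing here bears on `TropicalB` in its window, `WeakLifting`, DoorA26 /
DoorA34, `MatrixDescartes` (stmt-ValiantsHypothesis-18050) or VP ≠ VNP.

* `exists_arc_mem` — if `τ` moves some column, every column `c` lies in some arc.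
* `exists_arc_good` — for a column set `L` and a moved column `p ∉ L`: some arc `U j ∋ c` has its end `j ∉ L` or misses a column outside `L`
  (otherwise every arc through `c` would pass through `p`, and `U p ∌ c`… contradicting `cover_eq c p`).
* `moved_of_raised` — pairwise exchange on a singleton: if `P_B` is the EARLIER of two dominant terms and `d (λA x) < d (λB x)`, then `σA⁻¹σB x ≠ x`
  (and symmetrically `moved_of_lowered`).
[this cell; combinatorics folklore]
-/

set_option linter.dupNamespace false
set_option autoImplicit false

namespace Summit.ValiantsHypothesis.ValiantsHypothesis.Theorems.KPlusLogSqLaw.TopHeavyCore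

open Summit.ValiantsHypothesis.ValiantsHypothesis.Theorems.MatrixDescartes.Negative
open scoped BigOperators
open Finset

variable {m K : ℕ}

/-! ## 1. Arc choice -/

section Arc

variable (P τ : Equiv.Perm (Fin m)) (hfix : ∀ x, P x ≠ x) (hcyc : ∀ x y, P.SameCycle x y)
include hfix hcyc

/-- **every column lies in some arc** (as soon as `τ` moves a column). [this cell] -/
theorem exists_arc_mem (U : Fin m → Finset (Fin m)) (hUF : ∀ j, τ j ≠ j → (j ∈ U j ∧ P (τ⁻¹ j) ∈ U j ∧ (U j).card < m ∧ τ⁻¹ j ∉ U j ∧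
      (∀ x, x ∈ U j → x ≠ j → P x ∈ U j) ∧ P j ∉ U j ∧ (∀ x, x ∉ U j → P x ∈ U j → x = τ⁻¹ j))) (x c : Fin m) (hx : τ x ≠ x) :
    ∃ j, τ j ≠ j ∧ c ∈ U j := by
  classical
  have hxS : x ∈ ((univ.filter fun j => τ j ≠ j).filter fun j => x ∈ U j) :=
    mem_filter.mpr ⟨mem_filter.mpr ⟨mem_univ _, hx⟩, (hUF x hx).1⟩
  have hpos : 0 < ((univ.filter fun j => τ j ≠ j).filter fun j => c ∈ U j).card := by
    rw [cover_eq P τ hfix hcyc U hUF c x]; exact card_pos.mpr ⟨x, hxS⟩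
  obtain ⟨j, hj⟩ := card_pos.mp hpos
  exact ⟨j, (mem_filter.mp (mem_filter.mp hj).1).2, (mem_filter.mp hj).2⟩

/-- **ARC CHOICE.**  For a column set `L`, a moved column `p ∉ L` and any column `c`: some arc through `c` ends outside `L` or misses a column outside `L`.
[this cell] -/
theorem exists_arc_good (U : Fin m → Finset (Fin m)) (hUF : ∀ j, τ j ≠ j → (j ∈ U j ∧ P (τ⁻¹ j) ∈ U j ∧ (U j).card < m ∧ τ⁻¹ j ∉ U j ∧
      (∀ x, x ∈ U j → x ≠ j → P x ∈ U j) ∧ P j ∉ U j ∧ (∀ x, x ∉ U j → P x ∈ U j → x = τ⁻¹ j))) (L : Finset (Fin m)) (p c : Fin m)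
    (hpL : p ∉ L) (hp : τ p ≠ p) :
    ∃ j, τ j ≠ j ∧ c ∈ U j ∧ (j ∉ L ∨ ∃ x, x ∉ U j ∧ x ∉ L) := by
  classical
  by_contra hnone
  push Not at hnone
  set S := (univ.filter fun j => τ j ≠ j) with hS
  set Sc := S.filter fun j => c ∈ U j with hSc
  set Sp := S.filter fun j => p ∈ U j with hSp
  -- every arc through `c` passes through `p` (it covers everything outside `L`) …
  have hsub : Sc ⊆ Sp.erase p := by
    intro j hj
    obtain ⟨hjS, hjc⟩ := mem_filter.mp hj
    have hjτ : τ j ≠ j := (mem_filter.mp hjS).2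
    obtain ⟨hjL, hall⟩ := hnone j hjτ hjc
    have hpj : p ∈ U j := by
      by_contra h; exact hpL (hall p h)
    have hne : j ≠ p := fun h => hpL (h ▸ hjL)
    exact mem_erase.mpr ⟨hne, mem_filter.mpr ⟨hjS, hpj⟩⟩
  -- … and `U p ∋ p`, so `p` is covered more often than `c`
  have hpSp : p ∈ Sp := mem_filter.mpr ⟨mem_filter.mpr ⟨mem_univ _, hp⟩, (hUF p hp).1⟩
  have h1 : Sc.card ≤ Sp.card - 1 := by
    have := card_le_card hsub; rwa [card_erase_of_mem hpSp] at this
  have h2 : Sc.card = Sp.card := cover_eq P τ hfix hcyc U hUF c p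
  have h3 : 0 < Sp.card := card_pos.mpr ⟨p, hpSp⟩
  omega

end Arc

/-! ## 2. Singleton exchange: raised / lowered columns are moved -/

/-- **a strictly raised column is moved when `P_B` is earlier**: `θB < θA`, `d (λA x) < d (λB x)` ⇒ `σA⁻¹σB x ≠ x`. [this cell] -/
theorem moved_of_raised (d : Fin K → ℕ) (v ε : Fin m → Fin m → Fin K → ℤ) {σA σB : Equiv.Perm (Fin m)} {lA lB : Fin m → Fin K}
    {x : Fin m} {θA θB : ℤ} (hA : IsDominant d v ε θA (σA, lA)) (hB : IsDominant d v ε θB (σB, lB)) (hBA : θB < θA)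
    (hlt : d (lA x) < d (lB x)) : (σA⁻¹ * σB) x ≠ x := by
  classical
  intro hfx
  have hfx' : (σB⁻¹ * σA) x = x := by
    have : σB x = σA x := by
      rw [Equiv.Perm.mul_apply, Equiv.Perm.inv_eq_iff_eq] at hfx; exact hfx
    rw [Equiv.Perm.mul_apply, Equiv.Perm.inv_eq_iff_eq]; exact this.symm
  have hT : ∀ z, (σB⁻¹ * σA) z ∈ ({x} : Finset (Fin m)) ↔ z ∈ ({x} : Finset (Fin m)) := by
    intro z
    simp only [Finset.mem_singleton]
    constructor
    · intro h; exact (σB⁻¹ * σA).injective (h.trans hfx'.symm)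
    · intro h; rw [h]; exact hfx'
  have hcls : lB x ≠ lA x := fun h => by rw [h] at hlt; exact lt_irrefl _ hlt
  have hlaw := sum_d_lt_of_isDominant_invariant d v ε hBA hB hA ({x} : Finset (Fin m)) hT ⟨x, Finset.mem_singleton_self x, Or.inr hcls⟩
  rw [Finset.sum_singleton, Finset.sum_singleton] at hlaw
  have : (d (lA x) : ℤ) < d (lB x) := by exact_mod_cast hlt
  exact lt_asymm this hlaw

/-- **a strictly lowered column is moved when `P_A` is earlier**: `θA < θB`, `d (λB x) < d (λA x)` ⇒ `σA⁻¹σB x ≠ x`. [this cell] -/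
theorem moved_of_lowered (d : Fin K → ℕ) (v ε : Fin m → Fin m → Fin K → ℤ) {σA σB : Equiv.Perm (Fin m)} {lA lB : Fin m → Fin K}
    {x : Fin m} {θA θB : ℤ} (hA : IsDominant d v ε θA (σA, lA)) (hB : IsDominant d v ε θB (σB, lB)) (hAB : θA < θB)
    (hlt : d (lB x) < d (lA x)) : (σA⁻¹ * σB) x ≠ x := by
  intro hfx
  have h := moved_of_raised d v ε hB hA hAB hlt
  apply h
  have : σA x = σB x := by
    rw [Equiv.Perm.mul_apply, Equiv.Perm.inv_eq_iff_eq] at hfx; exact hfx.symm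
  rw [Equiv.Perm.mul_apply, Equiv.Perm.inv_eq_iff_eq]; exact this

end Summit.ValiantsHypothesis.ValiantsHypothesis.Theorems.KPlusLogSqLaw.TopHeavyCore
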